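import Summits.QuantumFields.YangMills.Theorems.LuscherReductionDressedRitzLiftLeakageKinematic
import HarnessLib

/-!
# Crux `DressedRitz` (stmt-QuantumFields-20205), line «polyakovlift» r5, stub S-LEAK `stub_liftLeakage` — support XX:
# ONE fine budget feeds S-LEAK and S-POS's NEAR slot: (NEAR₁) + (OUT) ⇒ the dressed FIRST-moment budget of `LiftPos.coreO5_of_slow_stiff` (pivot = own fine level)

Support module (fleet seat ym-20205-polyakovlift-s1 gen 1; `--supports stmt-QuantumFields-20205`, helper, no closure claim).  XIX (`FirstMomentCoreAt`, p547867)
located S-LEAK's renormalisation-group content as (NEAR₁) `Σ_{j∈S}|μ_j − μ_{j₀}|μ_j^{2L}⟨x,χ_j⟩² ≤ C_N(λ²/L)λ₀·μ_{j₀}^{2L}w₀` + (BAND) + (OUT)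
`‖x‖² − Σ_{j∈S}⟨x,χ_j⟩² ≤ C₂λ³w₀` + (CW) per dressed reference lift `u = K_β^[L]x`.  The lead's S-POS press-button `LiftPos.coreO5_of_slow_stiff` (p527993) consumes,
per dressed vector `u` and pivot `κ`, the FIRST-moment budget `Σ_j |λ_j − κ|⟨u,ψ_j⟩² + λ₀‖u − Σ_j⟨u,ψ_j⟩ψ_j‖² ≤ (1 − e^{−C₂′λ²/L})κ‖u‖²`.  This file proves that
(NEAR₁) + (OUT) GIVE that budget at the pivot `κ = μ_{j₀}` (own exact fine level), with the out-of-band part and the remainder handled by the FIRST-power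
kinematic bound `(2m+1)(μ − x)x^{2m} ≤ μ^{2m+1}` (`kinematic_bound (2m)`, XIV) — so ONE pair of estimates on the UNDRESSED flowed-Polyakov insertion state
serves both the leakage clause (o4) (via XIV∕XIX) and the NEAR slot of the position clause (o5) (via the lead's press-button, given his pivot∕level condition):

* `iterate_remainder_eq` — `K_β^[m]x − Σ_j⟨K_β^[m]x,χ_j⟩χ_j = K_β^[m](x − Σ_j⟨x,χ_j⟩χ_j)` (femto form of XI-a `iterate_remainder`);
* `firstMoment_out_term_le` — off the slow set (`0 ≤ μ_j ≤ μ`): `|μ_j − μ|μ_j^{2m}w ≤ (μ^{2m+1}/(2m+1))·w`;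
* ★★ `dressedFirstMoment_le` — `Σ_j|μ_j − μ|⟨u,χ_j⟩² + λ₀‖r_u‖² ≤ B + (μ^{2m+1}/(2m+1))·(‖x‖² − Σ_{j∈S}⟨x,χ_j⟩²)` for `u = K_β^[m]x`, given (NEAR₁) `≤ B` on `S`,
  off-`S` levels `≤ μ`, and the remainder gap `(2m+1)λ₀Λ^{2m} ≤ μ^{2m+1}`;
* ★★ `dressedFirstMoment_le_rate` — at `m = dressSteps L = L`, `λ ≤ 1`, `μ ≤ λ₀`: `… ≤ (C_N + C₂)(λ²/L)λ₀·μ^{2L}w₀ ≤ (C_N + C₂)(λ²/L)λ₀·‖u‖²`;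
* `le_one_sub_exp_neg_two_mul` (`y ≤ 1 − e^{−2y}` on `[0,1/2]`) and ★ `dressedFirstMoment_le_expForm` — the same in the lead's shape
  `≤ (1 − e^{−C′λ²/L})·(μ‖u‖²)` with `C′ = 4(C_N + C₂)`, when `2μ ≥ λ₀` and `2(C_N + C₂)λ²/L ≤ 1/2`.

HONEST FRAMING: fixed-lattice finite-sum bookkeeping on the conditional femto rung R2b1; `stub_liftLeakage` (and the NEAR∕level inputs of S-POS) stay OPEN;
nothing here bears on infinite volume, the continuum limit or the Clay gap.
References: M. Lüscher, NPB 219 (1983) 233 [cite: Luscher1983, §3]; M. Lüscher, U. Wolff, NPB 339 (1990) 222 [cite: LuscherWolff1990, §2];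
T. Kato, J. Phys. Soc. Japan 4 (1949) 334 [cite: Kato1949, §1]; M. Reed, B. Simon IV (1978) Thm XIII.1 [cite: ReedSimonIV1978].
-/

set_option autoImplicit false

noncomputable section

open MeasureTheory Filter Topology Finset
open Literature.MathematicalPhysics.QuantumFieldTheory
open Literature.MathematicalPhysics.QuantumLattice
open Literature.Analysis.OperatorTheory
open scoped BigOperators

namespace Summit.QuantumFields.YangMills.Theorems.FemtoTransferGap.LiftLeak

open Summit.QuantumFields.YangMills.Theorems.FemtoTransferGap
open Summit.QuantumFields.YangMills.Theorems.FemtoTransferGap.PolyakovLift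

variable {L : ℕ} [NeZero L]

/-- **The remainder commutes with the dressing (femto)**: `K_β^[m]x − Σ_j⟨K_β^[m]x,χ_j⟩χ_j = K_β^[m](x − Σ_j⟨x,χ_j⟩χ_j)`. [cite: ReedSimonIV1978, Thm XIII.1] -/
theorem iterate_remainder_eq (β : ℝ) {M : ℕ} {χ : Fin M → (GaugeConfig 3 L SU2 → ℝ)} (hχ : ∀ j, IsPhys (χ j))
    (μ : Fin M → ℝ) (heig : ∀ j, transferApply β (χ j) = μ j • χ j) {x : GaugeConfig 3 L SU2 → ℝ} (hx : IsPhys x) (m : ℕ) :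
    (transferApply β)^[m] x - ∑ j, l2 ((transferApply β)^[m] x) (χ j) • χ j = (transferApply β)^[m] (x - ∑ j, l2 x (χ j) • χ j) := by
  set e : Fin M → physSubmodule L := fun j => ⟨χ j, hχ j⟩ with he
  have heig' : ∀ j, transferOp β (e j) = μ j • e j := fun j => by
    apply Subtype.ext
    simpa only [coe_transferOp, Submodule.coe_smul, he, Submodule.coe_mk] using heig j
  have h := iterate_remainder (l2Form L) (transferOp β) (transferOp_symm β) e μ heig' ⟨x, hx⟩ m
  have h' := congrArg (fun y : physSubmodule L => (y : GaugeConfig 3 L SU2 → ℝ)) h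
  simpa only [l2Form_apply, coe_iterate_transferOp, Submodule.coe_sub, Submodule.coe_sum, Submodule.coe_smul, Submodule.coe_mk, he] using h'

/-- **First-power kinematic bound off the slow set**: for `0 ≤ μ_j ≤ μ`, `|μ_j − μ|·μ_j^{2m}·w ≤ (μ^{2m+1}/(2m+1))·w` (`w ≥ 0`). [folklore] -/
theorem firstMoment_out_term_le (m : ℕ) {x μ w : ℝ} (hx : 0 ≤ x) (hxμ : x ≤ μ) (hw : 0 ≤ w) :
    |x - μ| * x ^ (2 * m) * w ≤ μ ^ (2 * m + 1) / (2 * (m : ℝ) + 1) * w := by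
  have hk := kinematic_bound (2 * m) hx hxμ
  have hpos : (0 : ℝ) < 2 * (m : ℝ) + 1 := by positivity
  have hk' : (μ - x) * x ^ (2 * m) ≤ μ ^ (2 * m + 1) / (2 * (m : ℝ) + 1) := by
    rw [le_div_iff₀ hpos]
    calc (μ - x) * x ^ (2 * m) * (2 * (m : ℝ) + 1) = (((2 * m : ℕ) : ℝ) + 1) * ((μ - x) * x ^ (2 * m)) := by push_cast; ring
      _ ≤ μ ^ (2 * m + 1) := hk
  rw [abs_sub_comm, abs_of_nonneg (sub_nonneg.mpr hxμ)]
  exact mul_le_mul_of_nonneg_right hk' hw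

/-- ★★ **The dressed FIRST-moment budget from (NEAR₁) + the weight outside the slow set.**  `χ` an exact physical `l2`-orthonormal eigenfamily (levels `μ_j`)
dominating at `Λ ≥ 0` (`β ≥ 0`); `x` physical, `u = K_β^[m]x`; own index `j₀` (`μ = μ_{j₀}`); slow set `S` with `μ_j ≤ μ` off `S`; remainder gap
`(2m+1)λ₀Λ^{2m} ≤ μ^{2m+1}`; (NEAR₁) `Σ_{j∈S}|μ_j − μ|μ_j^{2m}⟨x,χ_j⟩² ≤ B`.  Then
`Σ_j|μ_j − μ|⟨u,χ_j⟩² + λ₀‖u − Σ_j⟨u,χ_j⟩χ_j‖² ≤ B + (μ^{2m+1}/(2m+1))·(‖x‖² − Σ_{j∈S}⟨x,χ_j⟩²)`. [cite: ReedSimonIV1978, Thm XIII.1] [cite: Luscher1983, §3] -/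
theorem dressedFirstMoment_le {β : ℝ} (hβ : 0 ≤ β) {M : ℕ} {χ : Fin M → (GaugeConfig 3 L SU2 → ℝ)} (hχ : ∀ j, IsPhys (χ j))
    (hon : ∀ i l, l2 (χ i) (χ l) = if i = l then 1 else 0) (μ : Fin M → ℝ)
    (heig : ∀ j, transferApply β (χ j) = μ j • χ j) {Λ : ℝ} (hΛ : 0 ≤ Λ)
    (hdom : ∀ φ : GaugeConfig 3 L SU2 → ℝ, IsPhys φ → (∀ j, l2 φ (χ j) = 0) → l2 φ (transferApply β φ) ≤ Λ * l2 φ φ)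
    {x : GaugeConfig 3 L SU2 → ℝ} (hx : IsPhys x) (m : ℕ) (j₀ : Fin M) (S : Finset (Fin M))
    (hS : ∀ j, j ∉ S → μ j ≤ μ j₀) (hgap : (2 * (m : ℝ) + 1) * levelValue su2Rep L β 0 * Λ ^ (2 * m) ≤ μ j₀ ^ (2 * m + 1)) {B : ℝ}
    (hnear : ∑ j ∈ S, |μ j - μ j₀| * μ j ^ (2 * m) * l2 x (χ j) ^ 2 ≤ B) :
    ∑ j, |μ j - μ j₀| * l2 ((transferApply β)^[m] x) (χ j) ^ 2 +
        levelValue su2Rep L β 0 *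
          l2 ((transferApply β)^[m] x - ∑ j, l2 ((transferApply β)^[m] x) (χ j) • χ j)
            ((transferApply β)^[m] x - ∑ j, l2 ((transferApply β)^[m] x) (χ j) • χ j) ≤
      B + μ j₀ ^ (2 * m + 1) / (2 * (m : ℝ) + 1) * (l2 x x - ∑ j ∈ S, l2 x (χ j) ^ 2) := by
  classical
  set μ₀ := μ j₀ with hμ₀
  set r := x - ∑ j, l2 x (χ j) • χ j with hr_def
  have hr : IsPhys r := by
    have hmem : r ∈ physSubmodule L := by
      rw [hr_def]; exact Submodule.sub_mem _ hx (Submodule.sum_mem _ fun j _ => Submodule.smul_mem _ _ (hχ j))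
    exact hmem
  have hrχ : ∀ j, l2 r (χ j) = 0 := l2_remainder_eq_zero hχ hon hx
  have hev0 : ∀ j, 0 ≤ μ j := eigen_nonneg hβ hχ hon μ heig
  have hμ00 : 0 ≤ μ₀ := hev0 j₀
  have hm : (0 : ℝ) < 2 * (m : ℝ) + 1 := by positivity
  set κ := μ₀ ^ (2 * m + 1) / (2 * (m : ℝ) + 1) with hκ
  have hκ0 : 0 ≤ κ := div_nonneg (pow_nonneg hμ00 _) hm.le
  set w : Fin M → ℝ := fun j => l2 x (χ j) ^ 2 with hw
  -- dressed weights and dressed remainder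
  have hwu : ∀ j, l2 ((transferApply β)^[m] x) (χ j) ^ 2 = μ j ^ (2 * m) * w j := fun j => by
    rw [l2_iterate_eigen β hx (hχ j) (heig j) m, mul_pow, ← pow_mul, hw]; ring_nf
  have hrem_eq := iterate_remainder_eq β hχ μ heig hx m
  obtain ⟨hremN, -⟩ := iterate_remainder_bounds hβ hχ μ heig hΛ hdom hr hrχ 0 m
  -- the stiff term
  have hl0 : 0 ≤ levelValue su2Rep L β 0 := by
    rcases M.eq_zero_or_pos with hM | hM
    · subst hM; exact Fin.elim0 j₀
    · -- `λ₀ ≥ 0` for `β ≥ 0`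
      exact levelValue_su2Rep_nonneg L hβ 0
  have hstiff : levelValue su2Rep L β 0 * l2 ((transferApply β)^[m] r) ((transferApply β)^[m] r) ≤ κ * l2 r r := by
    calc levelValue su2Rep L β 0 * l2 ((transferApply β)^[m] r) ((transferApply β)^[m] r)
        ≤ levelValue su2Rep L β 0 * (Λ ^ (2 * m) * l2 r r) := mul_le_mul_of_nonneg_left hremN hl0
      _ = (levelValue su2Rep L β 0 * Λ ^ (2 * m)) * l2 r r := by ring
      _ ≤ κ * l2 r r := by
          apply mul_le_mul_of_nonneg_right _ (l2_self_nonneg r)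
          rw [hκ, le_div_iff₀ hm]
          calc levelValue su2Rep L β 0 * Λ ^ (2 * m) * (2 * (m : ℝ) + 1) = (2 * (m : ℝ) + 1) * levelValue su2Rep L β 0 * Λ ^ (2 * m) := by ring
            _ ≤ μ₀ ^ (2 * m + 1) := hgap
  -- the sum, split over `S` and its complement
  set T : Fin M → ℝ := fun j => |μ j - μ₀| * μ j ^ (2 * m) * w j with hT
  have hsumT : ∑ j, T j = ∑ j ∈ S, T j + ∑ j ∈ Sᶜ, T j := (sum_add_sum_compl S T).symm
  have hsumw : ∑ j, w j = ∑ j ∈ S, w j + ∑ j ∈ Sᶜ, w j := (sum_add_sum_compl S w).symm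
  have hoff : ∑ j ∈ Sᶜ, T j ≤ κ * ∑ j ∈ Sᶜ, w j := by
    rw [mul_sum]
    refine sum_le_sum fun j hj => ?_
    exact firstMoment_out_term_le m (hev0 j) (hS j (mem_compl.mp hj)) (sq_nonneg _)
  have hnorm := normSq_split_eigenfamily hχ hon hx
  have hout : ∑ j ∈ Sᶜ, w j + l2 r r = l2 x x - ∑ j ∈ S, w j := by
    have : l2 x x = ∑ j, w j + l2 r r := hnorm
    rw [this, hsumw]; ring
  -- assemble
  have hlhs1 : ∑ j, |μ j - μ₀| * l2 ((transferApply β)^[m] x) (χ j) ^ 2 = ∑ j, T j :=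
    sum_congr rfl fun j _ => by rw [hwu j, hT]; ring
  rw [hlhs1, hrem_eq, hsumT]
  calc ∑ j ∈ S, T j + ∑ j ∈ Sᶜ, T j + levelValue su2Rep L β 0 * l2 ((transferApply β)^[m] r) ((transferApply β)^[m] r)
      ≤ B + κ * ∑ j ∈ Sᶜ, w j + κ * l2 r r := by linarith [hnear, hoff, hstiff]
    _ = B + κ * (∑ j ∈ Sᶜ, w j + l2 r r) := by ring
    _ = B + κ * (l2 x x - ∑ j ∈ S, w j) := by rw [hout]

/-- ★★ **Rate form at `m = dressSteps L = L`** (`λ ≤ 1`, `μ_{j₀} ≤ λ₀`, `C_N, C₂ ≥ 0`): with (NEAR₁) `≤ C_N(λ²/L)λ₀·μ^{2L}w₀` and (OUT) `≤ C₂λ³·w₀`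
(`w₀ = ⟨x,χ_{j₀}⟩²`), the dressed first-moment budget is `≤ (C_N + C₂)(λ²/L)λ₀·μ^{2L}w₀ ≤ (C_N + C₂)(λ²/L)λ₀·‖K_β^[L]x‖²` — the NEAR currency of S-POS.
[cite: Luscher1983, §3] [cite: LuscherWolff1990, §2] -/
theorem dressedFirstMoment_le_rate {β : ℝ} (hβ : 0 ≤ β) {M : ℕ} {χ : Fin M → (GaugeConfig 3 L SU2 → ℝ)} (hχ : ∀ j, IsPhys (χ j))
    (hon : ∀ i l, l2 (χ i) (χ l) = if i = l then 1 else 0) (μ : Fin M → ℝ)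
    (heig : ∀ j, transferApply β (χ j) = μ j • χ j) {Λ : ℝ} (hΛ : 0 ≤ Λ)
    (hdom : ∀ φ : GaugeConfig 3 L SU2 → ℝ, IsPhys φ → (∀ j, l2 φ (χ j) = 0) → l2 φ (transferApply β φ) ≤ Λ * l2 φ φ)
    {x : GaugeConfig 3 L SU2 → ℝ} (hx : IsPhys x) (j₀ : Fin M) (hμtop : μ j₀ ≤ levelValue su2Rep L β 0) (S : Finset (Fin M))
    (hS : ∀ j, j ∉ S → μ j ≤ μ j₀)
    (hgap : (2 * (dressSteps L : ℝ) + 1) * levelValue su2Rep L β 0 * Λ ^ (2 * dressSteps L) ≤ μ j₀ ^ (2 * dressSteps L + 1))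
    (hlam1 : luscherLambda β L ≤ 1) {C_N C₂ : ℝ} (hCN : 0 ≤ C_N) (hC₂ : 0 ≤ C₂)
    (hnear : ∑ j ∈ S, |μ j - μ j₀| * μ j ^ (2 * dressSteps L) * l2 x (χ j) ^ 2 ≤
      C_N * (luscherLambda β L ^ 2 / L) * levelValue su2Rep L β 0 * (μ j₀ ^ (2 * dressSteps L) * l2 x (χ j₀) ^ 2))
    (hout : l2 x x - ∑ j ∈ S, l2 x (χ j) ^ 2 ≤ C₂ * luscherLambda β L ^ 3 * l2 x (χ j₀) ^ 2) :
    ∑ j, |μ j - μ j₀| * l2 ((transferApply β)^[dressSteps L] x) (χ j) ^ 2 +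
        levelValue su2Rep L β 0 *
          l2 ((transferApply β)^[dressSteps L] x - ∑ j, l2 ((transferApply β)^[dressSteps L] x) (χ j) • χ j)
            ((transferApply β)^[dressSteps L] x - ∑ j, l2 ((transferApply β)^[dressSteps L] x) (χ j) • χ j) ≤
      (C_N + C₂) * (luscherLambda β L ^ 2 / L) * levelValue su2Rep L β 0 * (μ j₀ ^ (2 * dressSteps L) * l2 x (χ j₀) ^ 2) ∧
    (C_N + C₂) * (luscherLambda β L ^ 2 / L) * levelValue su2Rep L β 0 * (μ j₀ ^ (2 * dressSteps L) * l2 x (χ j₀) ^ 2) ≤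
      (C_N + C₂) * (luscherLambda β L ^ 2 / L) * levelValue su2Rep L β 0 *
        l2 ((transferApply β)^[dressSteps L] x) ((transferApply β)^[dressSteps L] x) := by
  set μ₀ := μ j₀ with hμ₀
  set l0 := levelValue su2Rep L β 0 with hl0
  set lam := luscherLambda β L with hlamdef
  have hμ00 : 0 ≤ μ₀ := eigen_nonneg hβ hχ hon μ heig j₀
  have hl00 : 0 ≤ l0 := hμ00.trans hμtop
  have hlam0 : 0 ≤ lam := by rw [hlamdef]; unfold luscherLambda; exact Real.rpow_nonneg (le_max_right _ _) _
  have hLpos : (0 : ℝ) < L := Nat.cast_pos.mpr (NeZero.pos L)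
  have hw0 : 0 ≤ l2 x (χ j₀) ^ 2 := sq_nonneg _
  have h1 := dressedFirstMoment_le hβ hχ hon μ heig hΛ hdom hx (dressSteps L) j₀ S hS hgap hnear
  -- the out-of-band term at `m = L`: `μ₀^{2L+1}/(2L+1)·C₂λ³w₀ ≤ C₂(λ²/L)λ₀·μ₀^{2L}w₀`
  have hm : (0 : ℝ) < 2 * (dressSteps L : ℝ) + 1 := by positivity
  have hout' : μ₀ ^ (2 * dressSteps L + 1) / (2 * (dressSteps L : ℝ) + 1) * (l2 x x - ∑ j ∈ S, l2 x (χ j) ^ 2) ≤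
      C₂ * (lam ^ 2 / L) * l0 * (μ₀ ^ (2 * dressSteps L) * l2 x (χ j₀) ^ 2) := by
    have hκ0 : 0 ≤ μ₀ ^ (2 * dressSteps L + 1) / (2 * (dressSteps L : ℝ) + 1) := div_nonneg (pow_nonneg hμ00 _) hm.le
    have hratio : lam ^ 3 / (2 * (dressSteps L : ℝ) + 1) ≤ lam ^ 2 / L := by
      simp only [dressSteps]
      have hm' : (0 : ℝ) < 2 * (L : ℝ) + 1 := by positivity
      rw [div_le_div_iff₀ hm' hLpos]
      calc lam ^ 3 * (L : ℝ) = lam ^ 2 * (lam * L) := by ring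
        _ ≤ lam ^ 2 * (1 * (2 * (L : ℝ) + 1)) := by
            apply mul_le_mul_of_nonneg_left _ (sq_nonneg _)
            exact mul_le_mul hlam1 (by linarith) hLpos.le zero_le_one
        _ = lam ^ 2 * (2 * (L : ℝ) + 1) := by ring
    calc μ₀ ^ (2 * dressSteps L + 1) / (2 * (dressSteps L : ℝ) + 1) * (l2 x x - ∑ j ∈ S, l2 x (χ j) ^ 2)
        ≤ μ₀ ^ (2 * dressSteps L + 1) / (2 * (dressSteps L : ℝ) + 1) * (C₂ * lam ^ 3 * l2 x (χ j₀) ^ 2) :=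
          mul_le_mul_of_nonneg_left hout hκ0
      _ = (μ₀ * (lam ^ 3 / (2 * (dressSteps L : ℝ) + 1))) * (C₂ * (μ₀ ^ (2 * dressSteps L) * l2 x (χ j₀) ^ 2)) := by
          field_simp
          ring
      _ ≤ (l0 * (lam ^ 2 / L)) * (C₂ * (μ₀ ^ (2 * dressSteps L) * l2 x (χ j₀) ^ 2)) := by
          apply mul_le_mul_of_nonneg_right _ (mul_nonneg hC₂ (mul_nonneg (pow_nonneg hμ00 _) hw0))
          exact mul_le_mul hμtop hratio (div_nonneg (pow_nonneg hlam0 3) hm.le) hl00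
      _ = C₂ * (lam ^ 2 / L) * l0 * (μ₀ ^ (2 * dressSteps L) * l2 x (χ j₀) ^ 2) := by ring
  refine ⟨h1.trans ?_, ?_⟩
  · calc C_N * (lam ^ 2 / L) * l0 * (μ₀ ^ (2 * dressSteps L) * l2 x (χ j₀) ^ 2) +
          μ₀ ^ (2 * dressSteps L + 1) / (2 * (dressSteps L : ℝ) + 1) * (l2 x x - ∑ j ∈ S, l2 x (χ j) ^ 2)
        ≤ C_N * (lam ^ 2 / L) * l0 * (μ₀ ^ (2 * dressSteps L) * l2 x (χ j₀) ^ 2) +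
          C₂ * (lam ^ 2 / L) * l0 * (μ₀ ^ (2 * dressSteps L) * l2 x (χ j₀) ^ 2) := by linarith [hout']
      _ = (C_N + C₂) * (lam ^ 2 / L) * l0 * (μ₀ ^ (2 * dressSteps L) * l2 x (χ j₀) ^ 2) := by ring
  · have hlev := normSq_iterate_ge_level β hχ hon μ heig hx (dressSteps L) j₀
    have hfac : 0 ≤ (C_N + C₂) * (lam ^ 2 / L) * l0 := mul_nonneg (mul_nonneg (add_nonneg hCN hC₂) (div_nonneg (sq_nonneg _) hLpos.le)) hl00
    exact mul_le_mul_of_nonneg_left hlev hfac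

/-- `y ≤ 1 − e^{−2y}` for `0 ≤ y ≤ 1/2` (`e^{2y} ≥ 1 + 2y` and `1/(1+2y) ≤ 1 − y`). [folklore] -/
theorem le_one_sub_exp_neg_two_mul {y : ℝ} (hy0 : 0 ≤ y) (hy : y ≤ 1 / 2) : y ≤ 1 - Real.exp (-(2 * y)) := by
  have h1 : 1 + 2 * y ≤ Real.exp (2 * y) := by linarith [Real.add_one_le_exp (2 * y)]
  have hpos : 0 < 1 + 2 * y := by linarith
  have h2 : Real.exp (-(2 * y)) ≤ 1 / (1 + 2 * y) := by
    rw [Real.exp_neg, ← one_div]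
    exact one_div_le_one_div_of_le hpos h1
  have h3 : 1 / (1 + 2 * y) ≤ 1 - y := by
    rw [div_le_iff₀ hpos]
    nlinarith
  linarith

/-- ★ **The lead's shape.**  Under the hypotheses of `dressedFirstMoment_le_rate`, if moreover `λ₀ ≤ 2μ_{j₀}` (own level within a factor two of the top —
eventually true at fixed `k`) and `2(C_N + C₂)λ²/L ≤ 1/2`, the dressed first-moment budget is
`≤ (1 − e^{−4(C_N+C₂)λ²/L})·(μ_{j₀}·‖K_β^[L]x‖²)` — the hypothesis format of `LiftPos.coreO5_of_slow_stiff` with pivot `κ = μ_{j₀}` and `C₂′ = 4(C_N + C₂)`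
(his remaining inputs: `κ`'s position against `μ_{i+1}(B)λ₀/μ₀`, i.e. LEVEL universality). [cite: Luscher1983, §3] -/
theorem dressedFirstMoment_le_expForm {β : ℝ} (hβ : 0 ≤ β) {M : ℕ} {χ : Fin M → (GaugeConfig 3 L SU2 → ℝ)} (hχ : ∀ j, IsPhys (χ j))
    (hon : ∀ i l, l2 (χ i) (χ l) = if i = l then 1 else 0) (μ : Fin M → ℝ)
    (heig : ∀ j, transferApply β (χ j) = μ j • χ j) {Λ : ℝ} (hΛ : 0 ≤ Λ)
    (hdom : ∀ φ : GaugeConfig 3 L SU2 → ℝ, IsPhys φ → (∀ j, l2 φ (χ j) = 0) → l2 φ (transferApply β φ) ≤ Λ * l2 φ φ)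
    {x : GaugeConfig 3 L SU2 → ℝ} (hx : IsPhys x) (j₀ : Fin M) (hμtop : μ j₀ ≤ levelValue su2Rep L β 0)
    (hμhalf : levelValue su2Rep L β 0 ≤ 2 * μ j₀) (S : Finset (Fin M)) (hS : ∀ j, j ∉ S → μ j ≤ μ j₀)
    (hgap : (2 * (dressSteps L : ℝ) + 1) * levelValue su2Rep L β 0 * Λ ^ (2 * dressSteps L) ≤ μ j₀ ^ (2 * dressSteps L + 1))
    (hlam1 : luscherLambda β L ≤ 1) {C_N C₂ : ℝ} (hCN : 0 ≤ C_N) (hC₂ : 0 ≤ C₂)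
    (hsmall : 2 * (C_N + C₂) * (luscherLambda β L ^ 2 / L) ≤ 1 / 2)
    (hnear : ∑ j ∈ S, |μ j - μ j₀| * μ j ^ (2 * dressSteps L) * l2 x (χ j) ^ 2 ≤
      C_N * (luscherLambda β L ^ 2 / L) * levelValue su2Rep L β 0 * (μ j₀ ^ (2 * dressSteps L) * l2 x (χ j₀) ^ 2))
    (hout : l2 x x - ∑ j ∈ S, l2 x (χ j) ^ 2 ≤ C₂ * luscherLambda β L ^ 3 * l2 x (χ j₀) ^ 2) :
    ∑ j, |μ j - μ j₀| * l2 ((transferApply β)^[dressSteps L] x) (χ j) ^ 2 +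
        levelValue su2Rep L β 0 *
          l2 ((transferApply β)^[dressSteps L] x - ∑ j, l2 ((transferApply β)^[dressSteps L] x) (χ j) • χ j)
            ((transferApply β)^[dressSteps L] x - ∑ j, l2 ((transferApply β)^[dressSteps L] x) (χ j) • χ j) ≤
      (1 - Real.exp (-(4 * (C_N + C₂) * luscherLambda β L ^ 2 / L))) *
        (μ j₀ * l2 ((transferApply β)^[dressSteps L] x) ((transferApply β)^[dressSteps L] x)) := by
  obtain ⟨h1, h2⟩ := dressedFirstMoment_le_rate hβ hχ hon μ heig hΛ hdom hx j₀ hμtop S hS hgap hlam1 hCN hC₂ hnear hout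
  set y := 2 * (C_N + C₂) * (luscherLambda β L ^ 2 / L) with hy
  have hLpos : (0 : ℝ) < L := Nat.cast_pos.mpr (NeZero.pos L)
  have hy0 : 0 ≤ y := by rw [hy]; exact mul_nonneg (mul_nonneg (by norm_num) (add_nonneg hCN hC₂)) (div_nonneg (sq_nonneg _) hLpos.le)
  have hexp := le_one_sub_exp_neg_two_mul hy0 hsmall
  have harg : -(2 * y) = -(4 * (C_N + C₂) * luscherLambda β L ^ 2 / L) := by rw [hy]; ring
  rw [harg] at hexp
  have hu0 : 0 ≤ l2 ((transferApply β)^[dressSteps L] x) ((transferApply β)^[dressSteps L] x) := l2_self_nonneg _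
  have hμ00 : 0 ≤ μ j₀ := eigen_nonneg hβ hχ hon μ heig j₀
  have hc0 : 0 ≤ (C_N + C₂) * (luscherLambda β L ^ 2 / L) := mul_nonneg (add_nonneg hCN hC₂) (div_nonneg (sq_nonneg _) hLpos.le)
  calc _ ≤ (C_N + C₂) * (luscherLambda β L ^ 2 / L) * levelValue su2Rep L β 0 *
        l2 ((transferApply β)^[dressSteps L] x) ((transferApply β)^[dressSteps L] x) := h1.trans h2
    _ ≤ (C_N + C₂) * (luscherLambda β L ^ 2 / L) * (2 * μ j₀) *
        l2 ((transferApply β)^[dressSteps L] x) ((transferApply β)^[dressSteps L] x) :=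
        mul_le_mul_of_nonneg_right (mul_le_mul_of_nonneg_left hμhalf hc0) hu0
    _ = y * (μ j₀ * l2 ((transferApply β)^[dressSteps L] x) ((transferApply β)^[dressSteps L] x)) := by rw [hy]; ring
    _ ≤ (1 - Real.exp (-(4 * (C_N + C₂) * luscherLambda β L ^ 2 / L))) *
        (μ j₀ * l2 ((transferApply β)^[dressSteps L] x) ((transferApply β)^[dressSteps L] x)) :=
        mul_le_mul_of_nonneg_right hexp (mul_nonneg hμ00 hu0)

end Summit.QuantumFields.YangMills.Theorems.FemtoTransferGap.LiftLeak

end
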